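import Literature.Barriers.CriticalPhenomena.SupercriticalSAWSpaceFillingBoxesRungs
import Literature.Probability.RandomPlanarGeometry.SquaredWalkPolygons
import Literature.Probability.Percolation.PlanarDuality
import HarnessLib

/-!
# Supercritical self-avoiding walks are space-filling (Duminil-Copin–Kozma–Yadin 2014):
# the frame of a box side and the standard link path, for the proof of Proposition 7 in the disk

Companion of `SupercriticalSAWSpaceFillingBoxes.lean` (H. Duminil-Copin, G. Kozma, A. Yadin,
*Supercritical self-avoiding walks are space-filling*, Ann. IHP Probab. Stat. 50 (2014) 315–326,
arXiv:1110.3074). The printed proof of Proposition 7 (p. 6–7) attaches to a walk `γ ∈ Θ_F` a link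
polygon `ℓ(γ)`: "it contains `e` and is included in `(Ω_δ ∖ 𝓔_F) ∪ {e}`, it intersects `γ` either
at just one edge, or at two adjacent edges only, it has length smaller than `100m` … One can easily
check that such a polygon always exists, see figure 7". This file supplies the lattice geometry
with which that sentence is made rigorous for the boxes with moats of the tree
(`SupercriticalSAWSpaceFillingBoxes.lean`: `innerBox`, `innerCardinalEdge`, `rungCells`,
`polygonRegion`, `thickBox`, `IsDeep`, `NearOutside`); the case analysis producing `ℓ(γ)` and the
proof of `DKY2014_prop7_disk` are in the sequel files.

* `frameIso n g z₀ i s σ : ℤ² ≃g ℤ²` — **the frame** of the box `B(z₀)`, its side `(i, s)` and a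
  lateral orientation `σ`: the lattice automorphism (a signed coordinate permutation followed by a
  translation, `zdSignedPermIso`/`zdShiftIso`) sending `(a, b)` to the site at forward distance
  `a` beyond the column of the inner cardinal edge `e` of `B(z₀)` on the side `(i, s)` and at
  lateral inner coordinate `b` (resp. `2n+1-b`). In the frame, uniformly in the four sides and
  two orientations: `e = {Φ(0,n), Φ(0,n+1)}` (`frame_innerCardinalEdge`), `B(z₀)` is
  `[-(2n+g+1), g] × I`, `I = [-g, 2n+g+1]` (`frame_mem_mBox_self`), the adjacent box
  `B(z₀ + dirVec i s)` is `[g+1, g+N] × I`, `N = 2(n+g)+2` (`frame_mem_mBox_dir_iff`), the next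
  one is `[g+N+1, g+2N] × I` (`frame_mem_mBox_dir_dir_iff`), everything within two box-widths
  is in the thickening of `B(z₀)` hence in `𝔻_δ` for a deep box and away from `a_δ, b_δ`
  (`frame_mem_thickBox`, `frame_mem_meshDomain`, `not_nearOutside_frame`), and the moat
  `[1, g] × I` in front of `e` is free of the polygon region when the adjacent box is not in `F`
  (`frame_not_mem_polygonRegion_moat`, `frame_site_props`); flipping `σ` reflects `b`
  (`frameIso_not`).
* `linkFn c n d` — **the standard link path** in frame coordinates for the first touched column
  `c ≥ 3` and the hook level `r = n + d`: `(c, r+1) → (1, r+1) → (1, n+1) → (0, n+1) → (0, n) →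
  (1, n) → (c-1, n) → (c-1, r) → (c, r)` (adjacent steps `linkFn_adj`, injective
  `linkFn_injective`, living in `{c} × {r, r+1} ∪ {0} × {n, n+1} ∪ [1, c-1] × [n, r+1]`,
  `linkFn_mem`), and its realisation `exists_linkWalk` as a self-avoiding lattice path through
  `e` (via `exists_walk_of_fn`, `isPath_of_support_eq_map`).
* Bookkeeping: inner coordinates of `mBox`/`innerBox`/`thickBox`/`rungCells`
  (`mem_*_iff_inner`), the boxes tile `ℤ²` (`eq_of_mem_mBox_of_mem_mBox`),
  `polygonRegion ⊆ V_F` (`polygonRegion_subset_boxVertices`), adjacency of `ℤ²` in coordinates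
  (`zdGraph_two_adj_vec_iff`, `zdGraph_two_adj_vec_vec_iff`, from
  `Literature.Probability.Percolation.zdGraph_two_adj_iff`).

Design: the frame makes the construction of `ℓ(γ)` independent of the side `(i, s)` of the box
and, through `σ`, of up/down symmetry, so that the sequel treats one configuration ("the walk
first touches the column `c` of the adjacent box, the hook sits at a level `r ≥ n`").
-/

noncomputable section

open Literature.Probability.LatticeModels Literature.Probability.Percolation
  Literature.Probability.RandomPlanarGeometry.SAW

namespace Literature.Barriers.CriticalPhenomena

namespace SupercriticalSAW

/-! ### Walks traced by a function -/

/-- A function `f : ℕ → V` with `f j ∼ f (j+1)` for `j < k` traces a walk from `f 0` to `f k` of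
length `k`, with support `[f 0, …, f k]` and edges `[s(f 0, f 1), …, s(f (k-1), f k)]`. [folklore] -/
theorem exists_walk_of_fn {V : Type*} {G : SimpleGraph V} (f : ℕ → V) :
    ∀ k : ℕ, (∀ j < k, G.Adj (f j) (f (j + 1))) →
      ∃ p : G.Walk (f 0) (f k), p.length = k ∧ p.support = (List.range (k + 1)).map f ∧
        p.edges = (List.range k).map fun j => s(f j, f (j + 1))
  | 0, _ => ⟨SimpleGraph.Walk.nil, rfl, by simp, by simp⟩
  | k + 1, h => by
    obtain ⟨p, hl, hs, he⟩ := exists_walk_of_fn f k fun j hj => h j (by omega)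
    refine ⟨p.concat (h k (by omega)), by simp [hl], ?_, ?_⟩
    · simp only [SimpleGraph.Walk.support_concat, hs, List.range_succ, List.map_append,
        List.map_singleton, List.append_assoc]
    · simp only [SimpleGraph.Walk.edges_concat, he, List.concat_eq_append, List.range_succ,
        List.map_append, List.map_singleton]

/-- A walk whose support is `[f 0, …, f k]` for `f` injective on `{0, …, k}` is a path. [folklore] -/
theorem isPath_of_support_eq_map {V : Type*} {G : SimpleGraph V} {u v : V} {p : G.Walk u v}
    {f : ℕ → V} {k : ℕ} (hs : p.support = (List.range (k + 1)).map f)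
    (hinj : ∀ j₁ < k + 1, ∀ j₂ < k + 1, f j₁ = f j₂ → j₁ = j₂) : p.IsPath := by
  rw [SimpleGraph.Walk.isPath_def, hs]
  exact List.Nodup.map_on (fun x hx y hy hxy => hinj x (List.mem_range.1 hx) y (List.mem_range.1 hy) hxy)
    List.nodup_range

/-! ### Coordinates of `ℤ²` -/

/-- Every index of `Fin 2` is `i` or `i + 1`. [folklore] -/
theorem fin_two_eq_or (i j : Fin 2) : j = i ∨ j = i + 1 := by
  fin_cases i <;> fin_cases j <;> simp

/-- Adjacency of `(a, b)` in `ℤ²`: the four neighbours. [folklore] -/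
theorem zdGraph_two_adj_vec_iff (a b : ℤ) (y : Site 2) :
    (zdGraph 2).Adj ![a, b] y ↔
      y = ![a + 1, b] ∨ y = ![a - 1, b] ∨ y = ![a, b + 1] ∨ y = ![a, b - 1] := by
  rw [zdGraph_two_adj_iff]
  simp only [funext_iff, Fin.forall_fin_two, Matrix.cons_val_zero, Matrix.cons_val_one]
  omega

/-! ### The frame of a box, a side and an orientation -/

/-- The signs of the frame: `+1`/`-1` on the forward axis `i` according to the side `s`, and on the
lateral axis `i + 1` according to the orientation `σ`. [folklore] -/
def frameSign (i : Fin 2) (s σ : Bool) : Fin 2 → ℤˣ := fun j =>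
  if j = i then (if s then 1 else -1) else (if σ then 1 else -1)

/-- The origin of the frame: the site of the column of the inner cardinal edge of `B(z₀)` on the
side `(i, s)` with lateral inner coordinate `0` (orientation `σ`) or `2n+1` (orientation `¬σ`).
[cite: DuminilCopinKozmaYadin2014, §3 (cardinal edges)] -/
def frameBase (n g : ℕ) (z₀ : Site 2) (i : Fin 2) (s σ : Bool) : Site 2 := fun j =>
  innerCorner n g z₀ j +
    if j = i then (if s then 2 * (n : ℤ) + 1 else 0) else (if σ then 0 else 2 * (n : ℤ) + 1)

/-- **The frame** of the box `B(z₀)`, the side `(i, s)` and the lateral orientation `σ`: the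
automorphism of `ℤ²` sending `(a, b)` to the site at forward distance `a` from the column of the
inner cardinal edge of `B(z₀)` on the side `(i, s)` (counted outwards, towards `B(z₀ + dirVec i s)`)
and at lateral inner coordinate `b` (if `σ`) or `2n + 1 - b` (if `¬σ`). In the frame the inner
cardinal edge is `{(0, n), (0, n+1)}`, the moat of `B(z₀)` in front of it is `1 ≤ a ≤ g`, and the
adjacent box is `g + 1 ≤ a ≤ g + N`, `N = 2(n+g)+2`. [cite: DuminilCopinKozmaYadin2014, §3 (proof of Proposition 7, the link ℓ(γ))] -/
def frameIso (n g : ℕ) (z₀ : Site 2) (i : Fin 2) (s σ : Bool) : zdGraph 2 ≃g zdGraph 2 :=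
  (zdSignedPermIso (Equiv.swap 0 i) (frameSign i s σ)).trans (zdShiftIso (frameBase n g z₀ i s σ))

section Frame

variable (n g : ℕ) (z₀ : Site 2) (i : Fin 2) (s σ : Bool)

/-- The forward coordinate of a framed site. [folklore] -/
theorem frameIso_apply_fwd (x : Site 2) :
    frameIso n g z₀ i s σ x i = innerCorner n g z₀ i + (if s then 2 * (n : ℤ) + 1 + x 0 else -x 0) := by
  fin_cases i <;> cases s <;> cases σ <;>
    simp [frameIso, frameSign, frameBase, RelIso.trans_apply] <;> ring

/-- The lateral coordinate of a framed site. [folklore] -/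
theorem frameIso_apply_lat (x : Site 2) :
    frameIso n g z₀ i s σ x (i + 1) =
      innerCorner n g z₀ (i + 1) + (if σ then x 1 else 2 * (n : ℤ) + 1 - x 1) := by
  fin_cases i <;> cases s <;> cases σ <;>
    simp [frameIso, frameSign, frameBase, RelIso.trans_apply] <;> ring

/-- Difference of the forward coordinates of two framed sites. [folklore] -/
theorem frameIso_fwd_sub_fwd (x x' : Site 2) :
    frameIso n g z₀ i s σ x i - frameIso n g z₀ i s σ x' i = if s then x 0 - x' 0 else x' 0 - x 0 := by
  rw [frameIso_apply_fwd, frameIso_apply_fwd]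
  split_ifs <;> ring

/-- Difference of the lateral coordinates of two framed sites. [folklore] -/
theorem frameIso_lat_sub_lat (x x' : Site 2) :
    frameIso n g z₀ i s σ x (i + 1) - frameIso n g z₀ i s σ x' (i + 1) =
      if σ then x 1 - x' 1 else x' 1 - x 1 := by
  rw [frameIso_apply_lat, frameIso_apply_lat]
  split_ifs <;> ring

/-- The forward inner coordinate of a framed site. [folklore] -/
theorem frameIso_fwd_sub (x : Site 2) :
    frameIso n g z₀ i s σ x i - innerCorner n g z₀ i = if s then 2 * (n : ℤ) + 1 + x 0 else -x 0 := by
  rw [frameIso_apply_fwd]; ring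

/-- The lateral inner coordinate of a framed site. [folklore] -/
theorem frameIso_lat_sub (x : Site 2) :
    frameIso n g z₀ i s σ x (i + 1) - innerCorner n g z₀ (i + 1) =
      if σ then x 1 else 2 * (n : ℤ) + 1 - x 1 := by
  rw [frameIso_apply_lat]; ring

/-- Adjacency to a framed site: the neighbours of `Φ x` are the `Φ x'`, `x' ∼ x`. [folklore] -/
theorem frame_adj_iff {x w : Site 2} :
    (zdGraph 2).Adj (frameIso n g z₀ i s σ x) w ↔
      ∃ x', w = frameIso n g z₀ i s σ x' ∧ (zdGraph 2).Adj x x' := by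
  constructor
  · intro h
    refine ⟨(frameIso n g z₀ i s σ).symm w, by simp, ?_⟩
    have := (frameIso n g z₀ i s σ).symm.map_adj_iff.mpr h
    simpa using this
  · rintro ⟨x', rfl, h⟩
    exact (frameIso n g z₀ i s σ).map_adj_iff.mpr h

/-! ### Inner coordinates of boxes -/

/-- The inner corner in coordinates: `N zⱼ + g`, `N = 2(n+g)+2`. [cite: DuminilCopinKozmaYadin2014, §3 (m-boxes)] -/
theorem innerCorner_apply (z : Site 2) (j : Fin 2) :
    innerCorner n g z j = (2 * ((n + g : ℕ) : ℤ) + 2) * z j + g := by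
  simp [innerCorner]

/-- The inner corner of a translated box. [cite: DuminilCopinKozmaYadin2014, §3 (m-boxes)] -/
theorem innerCorner_add (z w : Site 2) (j : Fin 2) :
    innerCorner n g (z + w) j = innerCorner n g z j + (2 * ((n + g : ℕ) : ℤ) + 2) * w j := by
  simp only [innerCorner_apply, Pi.add_apply]; ring

/-- Membership in `B(z)` in inner coordinates: `[-g, 2n+g+1]²`. [cite: DuminilCopinKozmaYadin2014, §3 (m-boxes)] -/
theorem mem_mBox_iff_inner {z v : Site 2} : v ∈ mBox (n + g) z ↔
    ∀ j, -(g : ℤ) ≤ v j - innerCorner n g z j ∧ v j - innerCorner n g z j ≤ 2 * n + g + 1 := by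
  rw [mem_mBox_iff]
  refine forall_congr' fun j => ?_
  rw [innerCorner_apply]
  push_cast
  constructor <;> rintro ⟨h1, h2⟩ <;> constructor <;> linarith

/-- Membership in the inner box in inner coordinates: `[0, 2n+1]²`. [cite: DuminilCopinKozmaYadin2014, §3 (m-boxes)] -/
theorem mem_innerBox_iff_inner {z v : Site 2} : v ∈ innerBox n g z ↔
    ∀ j, 0 ≤ v j - innerCorner n g z j ∧ v j - innerCorner n g z j ≤ 2 * n + 1 := by
  rw [mem_innerBox_iff]
  refine forall_congr' fun j => ?_
  rw [innerCorner_apply]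
  push_cast
  constructor <;> rintro ⟨h1, h2⟩ <;> constructor <;> linarith

/-- Membership in the thickened box in inner coordinates. [cite: DuminilCopinKozmaYadin2014, §3 (m-boxes)] -/
theorem mem_thickBox_iff_inner {z w : Site 2} : w ∈ thickBox (n + g) z ↔
    ∀ j, -(g : ℤ) - 2 * (2 * (n + g) + 2) ≤ w j - innerCorner n g z j ∧
      w j - innerCorner n g z j ≤ 2 * n + g + 1 + 2 * (2 * (n + g) + 2) := by
  rw [mem_thickBox_iff]
  refine forall_congr' fun j => ?_
  rw [innerCorner_apply]
  push_cast
  constructor <;> rintro ⟨h1, h2⟩ <;> constructor <;> linarith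

/-- Membership in a rung in inner coordinates: forward in `[2n+2, 2n+2g+1]`, lateral in `{n, n+1}`.
[cite: DuminilCopinKozmaYadin2014, §3 (proof of the Claim)] -/
theorem mem_rungCells_iff_inner {z v : Site 2} {j : Fin 2} : v ∈ rungCells n g z j ↔
    (2 * (n : ℤ) + 2 ≤ v j - innerCorner n g z j ∧ v j - innerCorner n g z j ≤ 2 * n + 2 * g + 1) ∧
      ((n : ℤ) ≤ v (j + 1) - innerCorner n g z (j + 1) ∧
        v (j + 1) - innerCorner n g z (j + 1) ≤ n + 1) := by
  simp only [rungCells, Finset.mem_image, Finset.mem_product, Finset.mem_range, Prod.exists]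
  constructor
  · rintro ⟨a, b, ⟨ha, hb⟩, rfl⟩
    simp
    omega
  · rintro ⟨⟨h1, h2⟩, h3, h4⟩
    refine ⟨(v j - innerCorner n g z j - (2 * n + 2)).toNat,
      (v (j + 1) - innerCorner n g z (j + 1) - n).toNat, ⟨by omega, by omega⟩, ?_⟩
    ext j'
    rcases fin_two_eq_or j j' with rfl | rfl
    · simp
      omega
    · simp
      omega

/-- Two boxes of the grid `(2m+2)ℤ²` sharing a site are equal (the boxes tile `ℤ²`).
[cite: DuminilCopinKozmaYadin2014, §3 (m-boxes)] -/
theorem eq_of_mem_mBox_of_mem_mBox {m : ℕ} {z z' v : Site 2} (h : v ∈ mBox m z)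
    (h' : v ∈ mBox m z') : z = z' := by
  rw [mem_mBox_iff] at h h'
  funext j
  obtain ⟨h1, h2⟩ := h j
  obtain ⟨h1', h2'⟩ := h' j
  by_contra hne
  rcases lt_or_gt_of_ne hne with hlt | hlt
  · have : (2 * (m : ℤ) + 2) * (z j + 1) ≤ (2 * (m : ℤ) + 2) * z' j :=
      mul_le_mul_of_nonneg_left (by omega) (by positivity)
    linarith
  · have : (2 * (m : ℤ) + 2) * (z' j + 1) ≤ (2 * (m : ℤ) + 2) * z j :=
      mul_le_mul_of_nonneg_left (by omega) (by positivity)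
    linarith

/-- A rung lies in its two boxes. [cite: DuminilCopinKozmaYadin2014, §3 (proof of the Claim)] -/
theorem mem_mBox_or_of_mem_rungCells {z v : Site 2} {j : Fin 2} (h : v ∈ rungCells n g z j) :
    v ∈ mBox (n + g) z ∨ v ∈ mBox (n + g) (z + Pi.single j 1) := by
  rw [mem_rungCells_iff_inner] at h
  obtain ⟨⟨h1, h2⟩, h3, h4⟩ := h
  by_cases hle : v j - innerCorner n g z j ≤ 2 * n + g + 1
  · left
    rw [mem_mBox_iff_inner]
    intro j'
    rcases fin_two_eq_or j j' with rfl | rfl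
    · constructor <;> omega
    · constructor <;> omega
  · right
    rw [mem_mBox_iff_inner]
    intro j'
    rcases fin_two_eq_or j j' with rfl | rfl
    · rw [innerCorner_add, Pi.single_eq_same]
      push_cast
      constructor <;> nlinarith
    · rw [innerCorner_add, Pi.single_eq_of_ne (fin_two_add_one_ne j)]
      constructor <;> omega

/-- The polygon region lies in the boxes: `polygonRegion n g F ⊆ V_F`.
[cite: DuminilCopinKozmaYadin2014, §3 (V_F, 𝓔_F)] -/
theorem polygonRegion_subset_boxVertices (F : Finset (Site 2)) :
    polygonRegion n g F ⊆ boxVertices (n + g) F := by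
  intro v hv
  rw [mem_boxVertices_iff]
  simp only [polygonRegion, Finset.mem_union, Finset.mem_biUnion, Finset.mem_univ, true_and,
    Finset.mem_filter] at hv
  rcases hv with ⟨z, hz, hv⟩ | ⟨j, z, ⟨hz, hzj⟩, hv⟩
  · exact ⟨z, hz, innerBox_subset_mBox n g z hv⟩
  · rcases mem_mBox_or_of_mem_rungCells n g hv with h | h
    · exact ⟨z, hz, h⟩
    · exact ⟨_, hzj, h⟩

/-- A site of a box not in the family is not a vertex of the family. [cite: DuminilCopinKozmaYadin2014, §3 (V_F)] -/
theorem not_mem_boxVertices_of_mem_mBox {m : ℕ} {F : Finset (Site 2)} {z v : Site 2} (hz : z ∉ F)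
    (hv : v ∈ mBox m z) : v ∉ boxVertices m F := by
  rw [mem_boxVertices_iff]
  rintro ⟨z', hz', hv'⟩
  exact hz (eq_of_mem_mBox_of_mem_mBox hv' hv ▸ hz')

/-! ### Framed sites in the boxes -/

/-- The forward unit vector in coordinates. [folklore] -/
theorem dirVec_apply_self : dirVec i s i = if s then 1 else -1 := by
  simp [dirVec]

/-- The forward unit vector has no lateral component. [folklore] -/
theorem dirVec_apply_succ : dirVec i s (i + 1) = 0 := by
  simp [dirVec]

/-- Framed sites with forward coordinate in `[-(2n+g+1), g]` and lateral coordinate in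
`I = [-g, 2n+g+1]` lie in `B(z₀)`. [cite: DuminilCopinKozmaYadin2014, §3 (m-boxes)] -/
theorem frame_mem_mBox_self {x : Site 2} (h0 : -(2 * (n : ℤ) + g + 1) ≤ x 0) (h0' : x 0 ≤ g)
    (h1 : -(g : ℤ) ≤ x 1) (h1' : x 1 ≤ 2 * n + g + 1) :
    frameIso n g z₀ i s σ x ∈ mBox (n + g) z₀ := by
  rw [mem_mBox_iff_inner]
  intro j
  rcases fin_two_eq_or i j with rfl | rfl
  · rw [frameIso_fwd_sub]
    cases s <;> simp <;> omega
  · rw [frameIso_lat_sub]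
    cases σ <;> simp <;> omega

/-- Framed sites in the adjacent box `B(z₀ + dirVec i s)`: forward coordinate in
`[g+1, g+N]`, lateral in `I`. [cite: DuminilCopinKozmaYadin2014, §3 (adjacent boxes)] -/
theorem frame_mem_mBox_dir_iff {x : Site 2} :
    frameIso n g z₀ i s σ x ∈ mBox (n + g) (z₀ + dirVec i s) ↔
      ((g : ℤ) + 1 ≤ x 0 ∧ x 0 ≤ 2 * n + 3 * g + 2) ∧ (-(g : ℤ) ≤ x 1 ∧ x 1 ≤ 2 * n + g + 1) := by
  rw [mem_mBox_iff_inner]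
  constructor
  · intro h
    have hi := h i
    have hi1 := h (i + 1)
    rw [innerCorner_add, dirVec_apply_self, ← sub_sub, frameIso_fwd_sub] at hi
    rw [innerCorner_add, dirVec_apply_succ, mul_zero, add_zero, frameIso_lat_sub] at hi1
    push_cast at hi hi1
    cases s <;> cases σ <;> simp at hi hi1 <;> omega
  · rintro ⟨⟨h0, h0'⟩, h1, h1'⟩ j
    rcases fin_two_eq_or i j with rfl | rfl
    · rw [innerCorner_add, dirVec_apply_self, ← sub_sub, frameIso_fwd_sub]
      push_cast
      cases s <;> simp <;> omega
    · rw [innerCorner_add, dirVec_apply_succ, mul_zero, add_zero, frameIso_lat_sub]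
      cases σ <;> simp <;> omega

/-- Framed sites in the box beyond the adjacent one, `B(z₀ + 2 dirVec i s)`: forward coordinate in
`[g+N+1, g+2N]`, lateral in `I`. [cite: DuminilCopinKozmaYadin2014, §3 (adjacent boxes)] -/
theorem frame_mem_mBox_dir_dir_iff {x : Site 2} :
    frameIso n g z₀ i s σ x ∈ mBox (n + g) (z₀ + dirVec i s + dirVec i s) ↔
      ((g : ℤ) + 1 + (2 * (n + g) + 2) ≤ x 0 ∧ x 0 ≤ 2 * n + 3 * g + 2 + (2 * (n + g) + 2)) ∧
        (-(g : ℤ) ≤ x 1 ∧ x 1 ≤ 2 * n + g + 1) := by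
  rw [mem_mBox_iff_inner]
  constructor
  · intro h
    have hi := h i
    have hi1 := h (i + 1)
    rw [innerCorner_add, innerCorner_add, dirVec_apply_self, ← sub_sub, ← sub_sub,
      frameIso_fwd_sub] at hi
    rw [innerCorner_add, innerCorner_add, dirVec_apply_succ, mul_zero, add_zero, add_zero,
      frameIso_lat_sub] at hi1
    push_cast at hi hi1
    cases s <;> cases σ <;> simp at hi hi1 <;> omega
  · rintro ⟨⟨h0, h0'⟩, h1, h1'⟩ j
    rcases fin_two_eq_or i j with rfl | rfl
    · rw [innerCorner_add, innerCorner_add, dirVec_apply_self, ← sub_sub, ← sub_sub,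
        frameIso_fwd_sub]
      push_cast
      cases s <;> simp <;> omega
    · rw [innerCorner_add, innerCorner_add, dirVec_apply_succ, mul_zero, add_zero, add_zero,
        frameIso_lat_sub]
      cases σ <;> simp <;> omega

/-- Framed sites within two box-widths of `B(z₀)` lie in its thickening.
[cite: DuminilCopinKozmaYadin2014, §3 (m-boxes)] -/
theorem frame_mem_thickBox {x : Site 2} (h0 : -(2 * (n : ℤ) + g + 1) - 2 * (2 * (n + g) + 2) ≤ x 0)
    (h0' : x 0 ≤ g + 2 * (2 * (n + g) + 2)) (h1 : -(g : ℤ) - 2 * (2 * (n + g) + 2) ≤ x 1)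
    (h1' : x 1 ≤ 2 * n + g + 1 + 2 * (2 * (n + g) + 2)) :
    frameIso n g z₀ i s σ x ∈ thickBox (n + g) z₀ := by
  rw [mem_thickBox_iff_inner]
  intro j
  rcases fin_two_eq_or i j with rfl | rfl
  · rw [frameIso_fwd_sub]
    cases s <;> simp <;> omega
  · rw [frameIso_lat_sub]
    cases σ <;> simp <;> omega

/-- Framed sites within two box-widths of a deep box are sites of `𝔻_δ`.
[cite: DuminilCopinKozmaYadin2014, §3 (m-boxes "included in Ω_δ")] -/
theorem frame_mem_meshDomain {δ : ℝ} (hdeep : IsDeep δ (n + g) z₀) {x : Site 2}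
    (h0 : -(2 * (n : ℤ) + g + 1) - 2 * (2 * (n + g) + 2) ≤ x 0)
    (h0' : x 0 ≤ g + 2 * (2 * (n + g) + 2)) (h1 : -(g : ℤ) - 2 * (2 * (n + g) + 2) ≤ x 1)
    (h1' : x 1 ≤ 2 * n + g + 1 + 2 * (2 * (n + g) + 2)) :
    frameIso n g z₀ i s σ x ∈ meshDomain unitDisk δ :=
  hdeep (frame_mem_thickBox n g z₀ i s σ h0 h0' h1 h1')

/-- Framed sites at least `5` inside the thickening of a deep box are not near the outside of
`𝔻_δ` (so they are not the endpoints `a_δ, b_δ`). [cite: DuminilCopinKozmaYadin2014, §1 (a_δ, b_δ)] -/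
theorem not_nearOutside_frame {δ : ℝ} (hdeep : IsDeep δ (n + g) z₀) {x : Site 2}
    (h0 : -(2 * (n : ℤ) + g + 1) - 2 * (2 * (n + g) + 2) + 5 ≤ x 0)
    (h0' : x 0 ≤ g + 2 * (2 * (n + g) + 2) - 5) (h1 : -(g : ℤ) - 2 * (2 * (n + g) + 2) + 5 ≤ x 1)
    (h1' : x 1 ≤ 2 * n + g + 1 + 2 * (2 * (n + g) + 2) - 5) :
    ¬ NearOutside δ (frameIso n g z₀ i s σ x) := by
  rintro ⟨w, hw, hdist⟩
  obtain ⟨x', rfl⟩ : ∃ x', w = frameIso n g z₀ i s σ x' :=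
    ⟨(frameIso n g z₀ i s σ).symm w, by simp⟩
  have hi := abs_le.mp (hdist i)
  have hi1 := abs_le.mp (hdist (i + 1))
  rw [frameIso_fwd_sub_fwd] at hi
  rw [frameIso_lat_sub_lat] at hi1
  refine hw (frame_mem_meshDomain n g z₀ i s σ hdeep ?_ ?_ ?_ ?_) <;> cases s <;> cases σ <;>
    simp at hi hi1 <;> omega

/-- Framed sites in the moat in front of the inner cardinal edge (`1 ≤ a ≤ g`, lateral in `I`)
are not in the polygon region, provided the adjacent box is not in the family.
[cite: DuminilCopinKozmaYadin2014, §3 (proof of Proposition 7, "ℓ … is included in (Ω_δ ∖ 𝓔_F) ∪ {e}")] -/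
theorem frame_not_mem_polygonRegion_moat {F : Finset (Site 2)} (hzd : z₀ + dirVec i s ∉ F)
    {x : Site 2} (h0 : 1 ≤ x 0) (h0' : x 0 ≤ g) (h1 : -(g : ℤ) ≤ x 1) (h1' : x 1 ≤ 2 * n + g + 1) :
    frameIso n g z₀ i s σ x ∉ polygonRegion n g F := by
  intro hv
  have hself : frameIso n g z₀ i s σ x ∈ mBox (n + g) z₀ :=
    frame_mem_mBox_self n g z₀ i s σ (by omega) h0' h1 h1'
  have hfwd := frameIso_fwd_sub n g z₀ i s σ x
  simp only [polygonRegion, Finset.mem_union, Finset.mem_biUnion, Finset.mem_univ, true_and,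
    Finset.mem_filter] at hv
  rcases hv with ⟨z, -, hv⟩ | ⟨j, z, ⟨hz, hzj⟩, hv⟩
  · -- inner box of `z = z₀`: forward inner coordinate in `[0, 2n+1]`
    have hz : z = z₀ := eq_of_mem_mBox_of_mem_mBox (innerBox_subset_mBox n g z hv) hself
    subst hz
    have := (mem_innerBox_iff_inner n g).mp hv i
    rw [hfwd] at this
    cases s <;> simp at this <;> omega
  · have hr := (mem_rungCells_iff_inner n g).mp hv
    rcases mem_mBox_or_of_mem_rungCells n g hv with h | h
    · -- rung of `z = z₀` towards `z₀ + e_j ∈ F`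
      have hz' : z = z₀ := eq_of_mem_mBox_of_mem_mBox h hself
      subst hz'
      rcases fin_two_eq_or i j with rfl | rfl
      · have h1 := hr.1
        rw [hfwd] at h1
        cases s
        · simp at h1; omega
        · exact hzd (by simpa [dirVec] using hzj)
      · -- rung of `z₀` along the lateral axis `i + 1`: its lateral coordinate is the forward one
        have h2 := hr.2
        rw [fin_two_add_one_add_one i, hfwd] at h2
        cases s <;> simp at h2 <;> omega
    · -- rung of `z` towards `z + e_j = z₀`
      have hzeq : z + Pi.single j 1 = z₀ := eq_of_mem_mBox_of_mem_mBox h hself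
      have hc : ∀ j', innerCorner n g z j' =
          innerCorner n g z₀ j' - (2 * ((n + g : ℕ) : ℤ) + 2) * (Pi.single j (1 : ℤ) : Site 2) j' :=
        fun j' => by rw [← hzeq, innerCorner_add]; ring
      rcases fin_two_eq_or i j with rfl | rfl
      · have h1 := hr.1
        rw [hc, Pi.single_eq_same, ← sub_add, hfwd] at h1
        push_cast at h1
        cases s
        · refine hzd ?_
          have : z = z₀ + dirVec j false := by
            rw [← hzeq]
            funext j'
            simp only [Pi.add_apply, dirVec]
            rcases fin_two_eq_or j j' with rfl | rfl
            · simp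
            · simp
          exact this ▸ hz
        · simp at h1; omega
      · have h2 := hr.2
        rw [fin_two_add_one_add_one i, hc, Pi.single_eq_of_ne (fin_two_add_one_ne i).symm, mul_zero, sub_zero,
          hfwd] at h2
        cases s <;> simp at h2 <;> omega

/-- **The inner cardinal edge in the frame**: it joins `Φ(0, n)` and `Φ(0, n+1)` (in either
order, according to the orientation `σ`). [cite: DuminilCopinKozmaYadin2014, §3 (cardinal edges)] -/
theorem frame_innerCardinalEdge :
    s(frameIso n g z₀ i s σ ![0, (n : ℤ)], frameIso n g z₀ i s σ ![0, (n : ℤ) + 1]) =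
      innerCardinalEdge n g z₀ i s := by
  have key : ∀ (b : ℤ) (j : Fin 2), frameIso n g z₀ i s σ ![0, b] j =
      innerCorner n g z₀ j + if j = i then (if s then 2 * (n : ℤ) + 1 else 0)
        else (if σ then b else 2 * n + 1 - b) := by
    intro b j
    rcases fin_two_eq_or i j with rfl | rfl
    · rw [frameIso_apply_fwd]; simp
    · rw [frameIso_apply_lat]; simp
  have h1 : frameIso n g z₀ i s σ ![0, (n : ℤ)] =
      if σ then innerCorner n g z₀ + fun j => if j = i then (if s then 2 * (n : ℤ) + 1 else 0) else (n : ℤ)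
      else (innerCorner n g z₀ + fun j => if j = i then (if s then 2 * (n : ℤ) + 1 else 0) else (n : ℤ)) +
        Pi.single (i + 1) 1 := by
    cases σ <;> funext j <;> rw [key] <;> rcases fin_two_eq_or i j with rfl | rfl <;> simp
    ring
  have h2 : frameIso n g z₀ i s σ ![0, (n : ℤ) + 1] =
      if σ then (innerCorner n g z₀ + fun j => if j = i then (if s then 2 * (n : ℤ) + 1 else 0) else (n : ℤ)) +
        Pi.single (i + 1) 1
      else innerCorner n g z₀ + fun j => if j = i then (if s then 2 * (n : ℤ) + 1 else 0) else (n : ℤ) := by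
    cases σ <;> funext j <;> rw [key] <;> rcases fin_two_eq_or i j with rfl | rfl <;> simp
    all_goals ring
  rw [h1, h2]
  cases σ <;> simp [innerCardinalEdge, Sym2.eq_swap]

end Frame

/-! ### The standard link path `W₀(c, r)` in frame coordinates -/

/-- Equality of sites of `ℤ²` given by their two coordinates. [folklore] -/
theorem vec2_eq_iff {a b a' b' : ℤ} : (![a, b] : Site 2) = ![a', b'] ↔ a = a' ∧ b = b' := by
  constructor
  · intro h
    exact ⟨by simpa using congrFun h 0, by simpa using congrFun h 1⟩
  · rintro ⟨rfl, rfl⟩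
    rfl

/-- Adjacency of two sites of `ℤ²` given by their coordinates. [folklore] -/
theorem zdGraph_two_adj_vec_vec_iff (a b a' b' : ℤ) :
    (zdGraph 2).Adj ![a, b] ![a', b'] ↔
      (a' = a + 1 ∧ b' = b) ∨ (a' = a - 1 ∧ b' = b) ∨ (a' = a ∧ b' = b + 1) ∨ (a' = a ∧ b' = b - 1) := by
  rw [zdGraph_two_adj_vec_iff]
  simp only [vec2_eq_iff]

/-- **The standard link path in frame coordinates.** For `c ≥ 3` (the first touched column) and
`r = n + d ≥ n` (the lateral level of the hook), the `2c + 2d + 2` sites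
`(c, r+1), (c-1, r+1), …, (1, r+1)` (along the upper level), `(1, r), …, (1, n+1)` (down the first
moat column), `(0, n+1), (0, n)` (the inner cardinal edge, reversed), `(1, n), …, (c-1, n)` (along
the level `n`), `(c-1, n+1), …, (c-1, r)` (up the last free column) and `(c, r)`: the link polygon
`ℓ(γ)` of the source minus its part on `γ`, traversed from `(c, r+1)` to `(c, r)`.
[cite: DuminilCopinKozmaYadin2014, §3 (proof of Proposition 7, the link ℓ(γ) and fig. polygexist)] -/
def linkFn (c n d : ℕ) (j : ℕ) : Site 2 :=
  if j + 1 ≤ c then ![(c : ℤ) - j, (n : ℤ) + d + 1]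
  else if j + 1 ≤ c + d then ![1, (n : ℤ) + d + c - j]
  else if j = c + d then ![0, (n : ℤ) + 1]
  else if j = c + d + 1 then ![0, (n : ℤ)]
  else if j ≤ 2 * c + d then ![(j : ℤ) - (c + d + 1), (n : ℤ)]
  else if j ≤ 2 * c + 2 * d then ![(c : ℤ) - 1, (n : ℤ) + j - (2 * c + d)]
  else ![(c : ℤ), (n : ℤ) + d]

section LinkFn

variable {c : ℕ} (n d : ℕ)

/-- The start of the standard link path. [folklore] -/
theorem linkFn_zero (hc : 3 ≤ c) : linkFn c n d 0 = ![(c : ℤ), (n : ℤ) + d + 1] := by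
  simp [linkFn, show 1 ≤ c by omega]

/-- The end of the standard link path. [folklore] -/
theorem linkFn_last (hc : 3 ≤ c) : linkFn c n d (2 * c + 2 * d + 1) = ![(c : ℤ), (n : ℤ) + d] := by
  unfold linkFn
  rw [if_neg (by omega), if_neg (by omega), if_neg (by omega), if_neg (by omega), if_neg (by omega),
    if_neg (by omega)]

/-- The standard link path passes through `(0, n+1)` … [folklore] -/
theorem linkFn_mid : linkFn c n d (c + d) = ![0, (n : ℤ) + 1] := by
  unfold linkFn
  rw [if_neg (by omega), if_neg (by omega), if_pos rfl]

/-- … and then through `(0, n)`: it contains the inner cardinal edge. [folklore] -/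
theorem linkFn_mid_succ : linkFn c n d (c + d + 1) = ![0, (n : ℤ)] := by
  unfold linkFn
  rw [if_neg (by omega), if_neg (by omega), if_neg (by omega), if_pos rfl]

/-- Consecutive sites of the standard link path are adjacent. [folklore] -/
theorem linkFn_adj (hc : 3 ≤ c) {j : ℕ} (hj : j < 2 * c + 2 * d + 1) :
    (zdGraph 2).Adj (linkFn c n d j) (linkFn c n d (j + 1)) := by
  simp only [linkFn]
  split_ifs <;> rw [zdGraph_two_adj_vec_vec_iff] <;> omega

/-- The standard link path is injective. [folklore] -/
theorem linkFn_injective (hc : 3 ≤ c) {j₁ : ℕ} (hj₁ : j₁ < 2 * c + 2 * d + 1 + 1) {j₂ : ℕ}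
    (hj₂ : j₂ < 2 * c + 2 * d + 1 + 1) (h : linkFn c n d j₁ = linkFn c n d j₂) : j₁ = j₂ := by
  simp only [linkFn] at h
  split_ifs at h <;> rw [vec2_eq_iff] at h <;> omega

/-- Where the standard link path lives: the two hook ends `(c, r+1)`, `(c, r)`, the inner cardinal
edge `(0, n)`, `(0, n+1)`, and otherwise the free rectangle `[1, c-1] × [n, r+1]`. [folklore] -/
theorem linkFn_mem (hc : 3 ≤ c) (j : ℕ) :
    ∃ a b : ℤ, linkFn c n d j = ![a, b] ∧
      ((a = c ∧ (b = n + d + 1 ∨ b = n + d)) ∨ (a = 0 ∧ (b = n ∨ b = n + 1)) ∨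
        (1 ≤ a ∧ a + 1 ≤ c ∧ (n : ℤ) ≤ b ∧ b ≤ n + d + 1)) := by
  simp only [linkFn]
  split_ifs <;> exact ⟨_, _, rfl, by omega⟩

end LinkFn

/-! ### The standard link path in the lattice -/

section LinkWalk

variable (n g : ℕ) (z₀ : Site 2) (i : Fin 2) (s σ : Bool)

/-- Flipping the lateral orientation of the frame reflects the lateral coordinate: `Φ_{¬σ}(a, b) =
Φ_σ(a, 2n+1-b)`. [folklore] -/
theorem frameIso_not (a b : ℤ) :
    frameIso n g z₀ i s (!σ) ![a, b] = frameIso n g z₀ i s σ ![a, 2 * n + 1 - b] := by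
  funext j
  rcases fin_two_eq_or i j with rfl | rfl
  · rw [frameIso_apply_fwd, frameIso_apply_fwd]
    simp
  · rw [frameIso_apply_lat, frameIso_apply_lat]
    cases σ <;> simp

/-- **The standard link path as a self-avoiding lattice path.** For `c ≥ 3` and `d ≥ 0` there is a
self-avoiding path of `ℤ²` from `Φ(c, n+d+1)` to `Φ(c, n+d)` of length `2c + 2d + 1` through the
sites `Φ(linkFn c n d j)`, containing the inner cardinal edge `{Φ(0, n+1), Φ(0, n)}`.
[cite: DuminilCopinKozmaYadin2014, §3 (proof of Proposition 7: "One can easily check that such a polygon always exists")] -/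
theorem exists_linkWalk {c : ℕ} (hc : 3 ≤ c) (d : ℕ) :
    ∃ p : (zdGraph 2).Walk (frameIso n g z₀ i s σ ![(c : ℤ), (n : ℤ) + d + 1])
        (frameIso n g z₀ i s σ ![(c : ℤ), (n : ℤ) + d]),
      p.IsPath ∧ p.length = 2 * c + 2 * d + 1 ∧
      (∀ w ∈ p.support, ∃ j, w = frameIso n g z₀ i s σ (linkFn c n d j)) ∧
      s(frameIso n g z₀ i s σ ![0, (n : ℤ) + 1], frameIso n g z₀ i s σ ![0, (n : ℤ)]) ∈ p.edges := by
  obtain ⟨p, hl, hs, he⟩ := exists_walk_of_fn (fun j => frameIso n g z₀ i s σ (linkFn c n d j))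
    (2 * c + 2 * d + 1) (fun j hj => (frameIso n g z₀ i s σ).map_adj_iff.mpr (linkFn_adj n d hc hj))
  refine ⟨p.copy (by simp [linkFn_zero n d hc]) (by simp [linkFn_last n d hc]), ?_, ?_, ?_, ?_⟩
  · rw [SimpleGraph.Walk.isPath_copy]
    exact isPath_of_support_eq_map hs fun j₁ h₁ j₂ h₂ h =>
      linkFn_injective n d hc h₁ h₂ ((frameIso n g z₀ i s σ).injective h)
  · rw [SimpleGraph.Walk.length_copy, hl]
  · intro w hw
    rw [SimpleGraph.Walk.support_copy, hs] at hw
    obtain ⟨j, -, rfl⟩ := List.mem_map.mp hw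
    exact ⟨j, rfl⟩
  · rw [SimpleGraph.Walk.edges_copy, he]
    refine List.mem_map.mpr ⟨c + d, List.mem_range.mpr (by omega), ?_⟩
    simp only [linkFn_mid, linkFn_mid_succ]

/-- **Sites of the link region.** For a deep box `B(z₀)` whose neighbour across the side `(i, s)`
is not in the family: a framed site `Φ(a, b)` with `0 ≤ a ≤ g + N` and `b ∈ I = [-g, 2n+g+1]`
(and `b ∈ {n, n+1}` if `a = 0`) is a site of `𝔻_δ`, lies in the thickening of `B(z₀)`, and meets
the polygon region only in the inner cardinal edge (the moat of `B(z₀)` and the box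
`B(z₀ + dirVec i s) ∌ F` are free of it). [cite: DuminilCopinKozmaYadin2014, §3 (proof of Proposition 7, "ℓ … is included in (Ω_δ ∖ 𝓔_F) ∪ {e}")] -/
theorem frame_site_props {δ : ℝ} {F : Finset (Site 2)} (hdeep : IsDeep δ (n + g) z₀)
    (hzd : z₀ + dirVec i s ∉ F) {a b : ℤ} (ha : 0 ≤ a) (ha' : a ≤ 2 * n + 3 * g + 2)
    (hb : -(g : ℤ) ≤ b) (hb' : b ≤ 2 * n + g + 1) (h0 : a = 0 → b = n ∨ b = n + 1) :
    frameIso n g z₀ i s σ ![a, b] ∈ meshDomain unitDisk δ ∧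
      frameIso n g z₀ i s σ ![a, b] ∈ thickBox (n + g) z₀ ∧
      (frameIso n g z₀ i s σ ![a, b] ∈ polygonRegion n g F →
        frameIso n g z₀ i s σ ![a, b] ∈ innerCardinalEdge n g z₀ i s) := by
  have hthick : frameIso n g z₀ i s σ ![a, b] ∈ thickBox (n + g) z₀ :=
    frame_mem_thickBox n g z₀ i s σ (by simp; omega) (by simp; omega) (by simp; omega)
      (by simp; omega)
  refine ⟨hdeep hthick, hthick, fun hpoly => ?_⟩
  rcases lt_trichotomy a 0 with hlt | rfl | hpos
  · omega
  · -- the two endpoints of the inner cardinal edge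
    rw [← frame_innerCardinalEdge n g z₀ i s σ, Sym2.mem_iff]
    rcases h0 rfl with rfl | rfl
    · exact Or.inl rfl
    · exact Or.inr rfl
  · exfalso
    by_cases hag : a ≤ g
    · exact frame_not_mem_polygonRegion_moat n g z₀ i s σ hzd (by simp; omega) (by simpa using hag)
        (by simpa using hb) (by simpa using hb') hpoly
    · refine not_mem_boxVertices_of_mem_mBox hzd ((frame_mem_mBox_dir_iff n g z₀ i s σ).mpr ?_)
        (polygonRegion_subset_boxVertices n g F hpoly)
      simp only [Matrix.cons_val_zero, Matrix.cons_val_one]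
      omega

end LinkWalk

end SupercriticalSAW

end Literature.Barriers.CriticalPhenomena
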